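import Summits.HubbardSuperconductivity.HubbardSuperconductivity.Theses.RelocationFloor

/-!
# Route `RelocationFloor`: the floor glue `RelocationFloorToUniformLRO` (stmt-HubbardSuperconductivity-15380)
# and the `Assembly` (stmt-HubbardSuperconductivity-15382)

`RelocationFloorToUniformLRO` — `B1gSignCoherence → BoundedPairRelocationWork → PairSiteDensity →` the uniform
every-ground-state `d`-wave floor `a·L⁴ ≤ Re⟨ψ, Δ_d†Δ_d ψ⟩` at some `(U, δ)` — is proved VERBATIM by the first half
(`have hF`) of the route's kernel-checked deciding theorem `Theses.RelocationFloor.closes` (planner-authored,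
2026-08-16): sign coherence gives `2ε` per relocated pair term, the bounded relocation work `e^{−K}` and the pair
site density `p₀` give `c₀ = ε e^{−K} p₀` per far displacement, and the near displacements (at most `(2R+1)²`)
are absorbed for `L ≥ L₁`.  This file records that proof under `Theorems/` so the item can be closed, and the
`Assembly` as `closes` itself.  Scalapino, Phys. Rep. 250 (1995) §2.  No definition is introduced.
-/

set_option linter.dupNamespace false
set_option linter.style.longLine false

noncomputable section

namespace Summit.HubbardSuperconductivity.HubbardSuperconductivity.Theorems.RelocationFloor

open scoped BigOperators Topology Classical Matrix InnerProductSpace ComplexConjugate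
open Filter Set Function
open Literature.MathematicalPhysics.QuantumLattice Literature.Probability.LatticeModels Matrix Finset
open Summit.HubbardSuperconductivity.HubbardSuperconductivity.Theses.RelocationFloor

/-- **`RelocationFloorToUniformLRO` holds** (route `RelocationFloor`, item `stmt-HubbardSuperconductivity-15380`):
the floor glue, verbatim the `have hF` block of the route's deciding theorem `closes`. Scalapino (1995) §2. [folklore] -/
theorem relocationFloorToUniformLRO_proof : RelocationFloorToUniformLRO := by
  have hcard : ∀ (M : ℕ) [NeZero M], (Fintype.card (TorusSite 2 M) : ℝ) = (M:ℝ)^2 := fun M _ => by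
    simp only [Fintype.card_pi, ZMod.card, prod_const, card_univ, Fintype.card_fin]; push_cast; ring
  unfold RelocationFloorToUniformLRO B1gSignCoherence BoundedPairRelocationWork PairSiteDensity
  intro h4 h3 hp
  obtain ⟨U, hU, δ, hδ, ε, hε, R₄, L₄, hK4⟩ := h4
  obtain ⟨K, R₃, L₃, hK3⟩ := h3 U hU δ hδ
  obtain ⟨p₀, hp₀, R₅, L₅, hP3⟩ := hp U hU δ hδ
  set S := unitSteps with hS
  set g := dWaveFormFactor with hg
  set R : ℕ := R₄ + R₃ + R₅ with hR
  set c₀ : ℝ := ε * Real.exp (-K) * p₀ with hc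
  have hc₀ : 0 < c₀ := by positivity
  set s : ℝ := (S.card : ℝ) with hs
  set N : ℝ := (((2 * R + 1)^2 : ℕ) : ℝ) with hN
  obtain ⟨L₁, hL₁⟩ := exists_nat_ge (2 * N * (c₀ + s^2) / c₀)
  refine ⟨U, by linarith [hU.1], δ, ⟨by linarith [hδ.1], by linarith [hδ.2]⟩, c₀, hc₀, L₄ + L₃ + L₅ + L₁ + 1, ?_⟩
  intro L _ hL hE ψ hψ hgs
  have hL₁L : (L₁:ℝ) ≤ L := by exact_mod_cast (show L₁ ≤ L by omega)
  have hL1 : (1:ℝ) ≤ L := by exact_mod_cast (show 1 ≤ L by omega)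
  set A := fun (x : TorusSite 2 L) (u : Site 2) => annihilation (orb (FermionTorus.ofTorusSite x) 0) * annihilation (orb (FermionTorus.ofTorusSite (x + Torus.proj L u)) 1) with hA
  set B := fun (x : TorusSite 2 L) (u : Site 2) => annihilation (orb (FermionTorus.ofTorusSite x) 1) * annihilation (orb (FermionTorus.ofTorusSite (x + Torus.proj L u)) 0) with hBd
  set φ := fun (r x : TorusSite 2 L) (e e' : Site 2) => ((A x e)ᴴ * A (x + r) e') *ᵥ ψ
  set F := fun (r : TorusSite 2 L) (e e' : Site 2) => g e' * (g e * ∑ x, (star ψ ⬝ᵥ φ r x e e').re) with hF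
  have hx : ∀ r, R ≤ torusDist r 0 → ∀ x, ∀ e ∈ S, ∀ e' ∈ S, Real.exp (-K) * p₀ / 2 ≤ ∑ τ, ‖ψ τ‖ * ‖φ r x e e' τ‖ := by
   intro r hr x e he e' he'
   have hd : R ≤ torusDist x (x + r) := by
    unfold torusDist at hr ⊢; rwa [show x - (x + r) = -r by abel, torusNorm_neg, ← sub_zero r]
   set ν := φ r x e e'
   set W := univ.filter fun τ => Real.exp (-K) * ‖ν τ‖ ≤ ‖ψ τ‖
   have k3 : (star ν ⬝ᵥ ν).re ≤ 2 * ∑ τ ∈ W, ‖ν τ‖^2 := hK3 L (by omega) hE ψ hψ hgs x (x + r) (le_trans (by omega) hd) e he e' he'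
   have p3 : p₀ ≤ (star ν ⬝ᵥ ν).re := hP3 L (by omega) hE ψ hψ hgs x (x + r) (le_trans (by omega) hd) e he e' he'
   calc Real.exp (-K) * p₀ / 2 ≤ Real.exp (-K) * ∑ τ ∈ W, ‖ν τ‖^2 := by nlinarith [Real.exp_pos (-K)]
    _ ≤ ∑ τ ∈ W, ‖ψ τ‖ * ‖ν τ‖ := by
      rw [mul_sum]; refine sum_le_sum fun τ hτ => ?_; rw [sq, ← mul_assoc]; exact mul_le_mul_of_nonneg_right (mem_filter.1 hτ).2 (norm_nonneg _)
    _ ≤ _ := sum_le_univ_sum_of_nonneg fun τ => mul_nonneg (norm_nonneg _) (norm_nonneg _)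
  have hov : ∀ r x e e', |(star ψ ⬝ᵥ φ r x e e').re| ≤ 1 := by
   intro r x e e'; have h := norm_toLp_sq_eq_re ψ; rw [hψ, Complex.one_re] at h; have n0 := (sq_le_one_iff₀ (norm_nonneg _)).1 h.le
   have n1 : ∀ y u, ‖WithLp.toLp 2 (A y u *ᵥ ψ)‖ ≤ 1 := by
    intro y u; simp only [hA, ← mulVec_mulVec]; exact ((norm_toLp_annihilation_mulVec_le _ _).trans (norm_toLp_annihilation_mulVec_le _ ψ)).trans n0
   have key : star ψ ⬝ᵥ φ r x e e' = star (A x e *ᵥ ψ) ⬝ᵥ (A (x + r) e' *ᵥ ψ) := PosSemidefTrace.expect_conjTranspose_mul _ _ ψ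
   rw [key, star_dotProduct_eq_inner]
   exact (Complex.abs_re_le_norm _).trans ((norm_inner_le_norm _ _).trans (mul_le_one₀ (n1 _ _) (norm_nonneg _) (n1 _ _)))
  have hg1 : ∀ e, |g e| ≤ 1 := fun e => by rw [hg]; unfold dWaveFormFactor; split_ifs <;> norm_num
  have E : (expect ((pairField g L)ᴴ * pairField g L) ψ).re = 2 * ∑ r, ∑ e' ∈ S, ∑ e ∈ S, F r e e' := by
   have E1 : pairField g L = (√2 : ℂ) • ∑ x, ∑ e ∈ S, (g e : ℂ) • A x e := by
    have ha : ∀ a b : Orb (FermionTorus 2 L), annihilation b * annihilation a = -(annihilation a * annihilation b) := fun a b => eq_neg_of_add_eq_zero_left (annihilation_anticommute_holds b a)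
    have hB : ∀ e, ∑ x, B x e = -∑ x, A x (-e) := fun e => by
     rw [← sum_neg_distrib]; refine Fintype.sum_equiv (Equiv.addRight (Torus.proj L e)) _ _ fun x => ?_
     simp only [hA, hBd, Equiv.coe_addRight, Torus.proj_neg, add_neg_cancel_right]; exact ha _ _
    have hm : ∀ e ∈ S, -e ∈ S := fun e he => by
     simp only [hS, unitSteps, Finset.mem_insert, Finset.mem_singleton] at he ⊢; rcases he with rfl | rfl | rfl | rfl <;> simp
    set w : Site 2 → ℂ := fun e => ((g e / √2 : ℝ) : ℂ) with hw
    have hT : ∑ e ∈ S, w e • ∑ x, A x (-e) = ∑ e ∈ S, w e • ∑ x, A x e := sum_nbij' (fun e => -e) (fun e => -e) hm hm (fun e _ => neg_neg e) (fun e _ => neg_neg e) fun e _ => by rw [show w (-e) = w e by simp only [hw, hg, dWaveFormFactor_neg]]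
    have hs : (√2 : ℂ) ≠ 0 := Complex.ofReal_ne_zero.2 (Real.sqrt_ne_zero'.2 two_pos)
    have h2 : (2 : ℂ) = (√2 : ℂ) * (√2 : ℂ) := by rw [← Complex.ofReal_mul, Real.mul_self_sqrt two_pos.le]; norm_num
    have h0 : (0 : Site 2) ∉ unitSteps := by simp only [unitSteps, Finset.mem_insert, Finset.mem_singleton]; decide
    calc pairField g L = ∑ e ∈ S, ∑ x, w e • (A x e - B x e) := by unfold pairField localPair; simp only [hA, hBd, hw, hg, hS]; rw [sum_comm, sum_insert h0, dWaveFormFactor_zero, zero_div, Complex.ofReal_zero]; simp only [zero_smul, sum_const_zero, zero_add]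
     _ = ∑ e ∈ S, w e • ∑ x, A x e + ∑ e ∈ S, w e • ∑ x, A x (-e) := by
       rw [← sum_add_distrib]; exact sum_congr rfl fun e _ => by rw [← smul_sum, sum_sub_distrib, hB, sub_neg_eq_add, smul_add]
     _ = ∑ e ∈ S, ((√2 : ℂ) * (g e : ℂ)) • ∑ x, A x e := by
       rw [hT, ← sum_add_distrib]
       exact sum_congr rfl fun e _ => by rw [← add_smul, ← two_mul]; simp only [hw, Complex.ofReal_div]; rw [h2, mul_assoc, ← mul_div_assoc, mul_div_cancel_left₀ _ hs]
     _ = (√2 : ℂ) • ∑ x, ∑ e ∈ S, (g e : ℂ) • A x e := by simp only [smul_sum, smul_smul]; exact sum_comm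
   rw [E1, conjTranspose_smul, Matrix.smul_mul, Matrix.mul_smul, smul_smul, expect_smul, Complex.star_def, Complex.conj_ofReal, ← Complex.ofReal_mul, Complex.re_ofReal_mul, Real.mul_self_sqrt two_pos.le]
   congr 1; rw [conjTranspose_sum, sum_mul, expect_sum, Complex.re_sum]; simp only [Matrix.mul_sum, expect_sum, Complex.re_sum]
   have st : ∀ f : TorusSite 2 L → TorusSite 2 L → ℝ, ∑ x, ∑ y, f x y = ∑ r, ∑ x, f x (x + r) := fun f => (sum_congr rfl fun x _ => (Fintype.sum_equiv (Equiv.addLeft x) _ _ fun r => rfl).symm).trans sum_comm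
   rw [st]; refine sum_congr rfl fun r _ => ?_
   simp only [hF, conjTranspose_sum, conjTranspose_smul, Complex.star_def, Complex.conj_ofReal, Matrix.sum_mul, Matrix.smul_mul, Matrix.mul_smul, expect_sum, expect_smul, Complex.re_sum, Complex.re_ofReal_mul, mul_sum]
   rw [sum_comm]; exact sum_congr rfl fun e' _ => sum_comm
  rw [E]
  have far : ∀ r, R ≤ torusDist r 0 → c₀ * (L:ℝ)^2 ≤ ∑ e' ∈ S, ∑ e ∈ S, F r e e' := by
   intro r hr
   have hi : ∀ e ∈ S, ∀ e' ∈ S, c₀ * (L:ℝ)^2 ≤ F r e e' := by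
    intro e he e' he'
    refine le_trans ?_ ((hK4 L (by omega) hE ψ hψ hgs r (le_trans (by omega) hr) e he e' he').trans_eq (by simp only [hF]; ring))
    calc c₀ * (L:ℝ)^2 = 2 * ε * ∑ x : TorusSite 2 L, Real.exp (-K) * p₀ / 2 := by rw [sum_const, card_univ, nsmul_eq_mul, hcard L, hc]; ring
     _ ≤ _ := mul_le_mul_of_nonneg_left (sum_le_sum fun x _ => hx r hr x e he e' he') (by positivity)
   have h0 : 0 ≤ c₀ * (L:ℝ)^2 := by positivity
   have hm : (Pi.single 0 1 : Site 2) ∈ S := mem_insert_self _ _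
   exact ((hi _ hm _ hm).trans (single_le_sum (fun e he => h0.trans (hi e he _ hm)) hm)).trans (single_le_sum (fun e' he' => sum_nonneg fun e he => h0.trans (hi e he e' he')) hm)
  have near : ∀ r, -(s^2 * (L:ℝ)^2) ≤ ∑ e' ∈ S, ∑ e ∈ S, F r e e' := by
   intro r
   have ht : ∀ e e', -(L:ℝ)^2 ≤ F r e e' := fun e e' => by
    have hsum : |∑ x, (star ψ ⬝ᵥ φ r x e e').re| ≤ (L:ℝ)^2 := (abs_sum_le_sum_abs _ _).trans (le_of_le_of_eq (sum_le_sum fun x _ => hov r x e e') (by rw [sum_const, card_univ, nsmul_eq_mul, mul_one, hcard L]))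
    refine neg_le_of_abs_le ?_; simp only [hF, abs_mul]
    exact (mul_le_mul (hg1 e') (mul_le_mul (hg1 e) hsum (abs_nonneg _) zero_le_one) (mul_nonneg (abs_nonneg _) (abs_nonneg _)) zero_le_one).trans_eq (by ring)
   calc -(s^2 * (L:ℝ)^2) = ∑ _e ∈ S, ∑ _e' ∈ S, -(L:ℝ)^2 := by rw [sum_const, sum_const, nsmul_eq_mul, nsmul_eq_mul]; ring
    _ ≤ _ := sum_le_sum fun e' _ => sum_le_sum fun e _ => ht e e'
  set P := fun r : TorusSite 2 L => R ≤ torusDist r 0 with hP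
  rw [← sum_filter_add_sum_filter_not univ P]
  set nf : ℝ := ((univ.filter P).card : ℝ) with hnf
  set nn : ℝ := ((univ.filter fun r => ¬P r).card : ℝ) with hnn
  have hfar := card_nsmul_le_sum (univ.filter P) (fun r => ∑ e' ∈ S, ∑ e ∈ S, F r e e') _ fun r hr => far r (mem_filter.1 hr).2
  have hnear := card_nsmul_le_sum (univ.filter fun r => ¬P r) (fun r => ∑ e' ∈ S, ∑ e ∈ S, F r e e') _ fun r _ => near r
  rw [nsmul_eq_mul, ← hnf] at hfar; rw [nsmul_eq_mul, ← hnn] at hnear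
  have hcnt : nf + nn = (L:ℝ)^2 := by rw [hnf, hnn, ← Nat.cast_add, card_filter_add_card_filter_not, card_univ, hcard L]
  have hnN : nn ≤ N := by
   set Bz : Finset (ZMod L) := univ.filter fun z : ZMod L => min z.val (L - z.val) ≤ R with hBz
   have hsub : ∀ u ∈ (univ.filter fun r => ¬P r), u - 0 ∈ Fintype.piFinset fun _ : Fin 2 => Bz := by
    intro u hu; simp only [hP, mem_filter, Finset.mem_univ, true_and, not_le] at hu; unfold torusDist at hu; simp only [torusNorm] at hu
    rw [Fintype.mem_piFinset]; intro i; simp only [hBz, mem_filter, Finset.mem_univ, true_and]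
    exact (Finset.le_sup (f := fun i => min ((u - 0) i).val (L - ((u - 0) i).val)) (Finset.mem_univ i)).trans hu.le
   rw [hnn, hN]
   exact_mod_cast (card_le_card_of_injOn (fun u => u - 0) hsub fun u _ v _ h => by simpa using h).trans ((Fintype.card_piFinset_const _ _).trans_le (Nat.pow_le_pow_left (card_filter_cyclicAbs_le_le R) 2))
  have key : 2 * N * (c₀ + s^2) ≤ c₀ * (L:ℝ)^2 :=
   calc 2 * N * (c₀ + s^2) ≤ (L₁:ℝ) * c₀ := (div_le_iff₀ hc₀).1 hL₁
    _ ≤ (L:ℝ)^2 * c₀ := mul_le_mul_of_nonneg_right (by nlinarith) hc₀.le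
    _ = _ := mul_comm _ _
  have i5 : nf * (c₀ * (L:ℝ)^2) = c₀ * (L:ℝ)^2 * (L:ℝ)^2 - nn * (c₀ * (L:ℝ)^2) := by
   rw [← hcnt]; ring
  linarith [hfar, hnear, i5, mul_le_mul_of_nonneg_right hnN (by positivity : (0:ℝ) ≤ (c₀ + s^2) * (L:ℝ)^2), mul_le_mul_of_nonneg_right key (by positivity : (0:ℝ) ≤ (L:ℝ)^2)]

/-- **Route RelocationFloor's `Assembly` holds** (item `stmt-HubbardSuperconductivity-15382`): the composition
`B1gSignCoherence → BoundedPairRelocationWork → PairSiteDensity → RelocationFloorToUniformLRO →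
UniformLROGivesSummitMatrix → HubbardSuperconductivity` is the route's deciding theorem `closes` (which uses only
the first three binders). [folklore] -/
theorem relocationFloor_assembly_proof : Assembly :=
  fun h4 h3 hp _ _ => closes h4 h3 hp

end Summit.HubbardSuperconductivity.HubbardSuperconductivity.Theorems.RelocationFloor
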